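import Summits.Ventures.CertifiedArithmetic.LowPrec.SRHoeffdingFormats
import HarnessLib

/-!
# Window-local constants: the SR envelopes with the LOCAL spacing of the range actually visited

HONEST FRAMING: certified error envelopes and provably optimal rounding/accumulation schemes for
low-precision formats under stated cost models; every table by two implementations; no hardware or
vendor claims.

The format instances of `SREnvelopes` / `SRHoeffdingFormats` use the TOP-binade spacing `G` of the
format (E4M3: `32`), which is the honest all-input constant but very pessimistic when the partial sums
stay small — Connolly–Higham–Mary's bounds scale with `u · max|partial sum|`, not with `u · max F`.  This
file gives the faithful finite-format analogue: a decidable path predicate `InWindow F lo hi` (every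
pre-rounding value on every branch lies in `[lo, hi]`), a WINDOW successor certificate
(`∀ a ∈ F, lo ≤ a < hi → succ(a) ≤ a + G`, a `|F|`-sized kernel check), and
`gapLE_of_window : InWindow ⇒ GapLE G`; hence `accVar ≤ nG²/4`, Chebyshev and the exponential tail
with the LOCAL `G`.  Kernel instances: E4M3 on `[−16, 16]` has `G = 1` (tail `2e^{−2t²/n}` instead of
the global `2e^{−t²/(512n)}`), E5M2 on `[−256, 256]` has `G = 32`, E2M1 on `[−2, 2]` has `G = 1/2`.
-/

namespace Summit.Ventures.CertifiedArithmetic.LowPrec.SR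

open Literature.ComputerArithmetic.ConnollyHighamMary2021
open Finset

variable {K : Type*} [Field K] [LinearOrder K] [IsStrictOrderedRing K]

/-! ### Window successor certificate ⇒ gap bound -/

/-- Candidate gap bound on a window `[lo, hi]` (both endpoints format values) from the successor
property of `F` restricted to the window. -/
theorem gap_le_of_succ_window {F : Finset K} {lo hi G : K} (hlo : lo ∈ F) (hhi : hi ∈ F) (hG : 0 ≤ G)
    (hsucc : ∀ a ∈ F, lo ≤ a → a < hi → ∃ b ∈ F, a < b ∧ b ≤ a + G) {x : K} (hlx : lo ≤ x)
    (hxh : x ≤ hi) : roundUp F x - roundDown F x ≤ G := by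
  have hd : roundDown F x ∈ F := roundDown_mem ⟨lo, hlo, hlx⟩
  have hld : lo ≤ roundDown F x := le_roundDown_of_mem hlo hlx
  by_cases hdh : roundDown F x < hi
  · obtain ⟨b, hb, hdb, hbG⟩ := hsucc _ hd hld hdh
    have hxb : x ≤ b := by
      by_contra hlt
      exact absurd (le_roundDown_of_mem hb (le_of_lt (lt_of_not_ge hlt))) (not_le.mpr hdb)
    have hub : roundUp F x ≤ b := roundUp_le_of_mem hb hxb
    linarith [roundDown_le F x]
  · have hxeq : x = hi := le_antisymm hxh ((not_lt.mp hdh).trans (roundDown_le F x))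
    rw [hxeq, roundUp_eq_self_of_mem hhi, roundDown_eq_self_of_mem hhi, sub_self]; exact hG

/-! ### The path predicate `InWindow` -/

/-- `InWindow F lo hi x n s`: along every branch of the outcome tree of `ŝ₀ = s, ŝₖ₊₁ = SR(ŝₖ + xₖ)`,
every (clamped) pre-rounding value lies in the window `[lo, hi]`. -/
def InWindow (F : Finset K) (lo hi : K) : (ℕ → K) → ℕ → K → Prop
  | _, 0, _ => True
  | x, n + 1, s => (lo ≤ clamp F (s + x 0) ∧ clamp F (s + x 0) ≤ hi)
      ∧ InWindow F lo hi (fun i => x (i + 1)) n (up F (s + x 0))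
      ∧ InWindow F lo hi (fun i => x (i + 1)) n (dn F (s + x 0))

/-- Boolean evaluator of `InWindow`. -/
def inWindowB (F : Finset K) (lo hi : K) : (ℕ → K) → ℕ → K → Bool
  | _, 0, _ => true
  | x, n + 1, s => decide (lo ≤ clamp F (s + x 0) ∧ clamp F (s + x 0) ≤ hi)
      && inWindowB F lo hi (fun i => x (i + 1)) n (up F (s + x 0))
      && inWindowB F lo hi (fun i => x (i + 1)) n (dn F (s + x 0))

omit [IsStrictOrderedRing K] in
/-- `inWindowB` computes `InWindow`. -/
theorem inWindowB_iff (F : Finset K) (lo hi : K) (x : ℕ → K) (n : ℕ) (s : K) :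
    inWindowB F lo hi x n s = true ↔ InWindow F lo hi x n s := by
  induction n generalizing x s with
  | zero => simp [inWindowB, InWindow]
  | succ n ih => simp [inWindowB, InWindow, ih, Bool.and_eq_true, and_assoc]

/-- `InWindow` is decidable (via `inWindowB`). -/
instance instDecidableInWindow (F : Finset K) (lo hi : K) (x : ℕ → K) (n : ℕ) (s : K) :
    Decidable (InWindow F lo hi x n s) :=
  decidable_of_iff _ (inWindowB_iff F lo hi x n s)

/-- **Window certificate ⇒ `GapLE` with the local constant.** -/
theorem gapLE_of_window {F : Finset K} {lo hi G : K} (hlo : lo ∈ F) (hhi : hi ∈ F) (hG : 0 ≤ G)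
    (hsucc : ∀ a ∈ F, lo ≤ a → a < hi → ∃ b ∈ F, a < b ∧ b ≤ a + G) :
    ∀ (x : ℕ → K) (n : ℕ) (s : K), InWindow F lo hi x n s → GapLE F G x n s := by
  intro x n
  induction n generalizing x with
  | zero => intro s _; trivial
  | succ n ih =>
      intro s h
      obtain ⟨⟨h1, h2⟩, hu, hd⟩ := h
      exact ⟨gap_le_of_succ_window hlo hhi hG hsucc h1 h2, ih _ _ hu, ih _ _ hd⟩

/-- Variance envelope with the window-local spacing: `InWindow ⇒ accVar ≤ n G²/4`. -/
theorem accVar_le_of_window {F : Finset K} {lo hi G : K} (hlo : lo ∈ F) (hhi : hi ∈ F) (hG : 0 ≤ G)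
    (hsucc : ∀ a ∈ F, lo ≤ a → a < hi → ∃ b ∈ F, a < b ∧ b ≤ a + G) (x : ℕ → K) (n : ℕ) (s : K)
    (hw : InWindow F lo hi x n s) : accVar F x n s ≤ n * G ^ 2 / 4 :=
  accVar_le F G x n s (gapLE_of_window hlo hhi hG hsucc x n s hw)

/-- Chebyshev `√n` law with the window-local spacing. -/
theorem prob_dev_ge_le_of_window {F : Finset K} {lo hi G : K} (hlo : lo ∈ F) (hhi : hi ∈ F)
    (hG : 0 ≤ G) (hsucc : ∀ a ∈ F, lo ≤ a → a < hi → ∃ b ∈ F, a < b ∧ b ≤ a + G) (x : ℕ → K)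
    (n : ℕ) (s : K) (h : NoSat F x n s) (hw : InWindow F lo hi x n s) {t : K} (ht : 0 < t) :
    accExp F x n (devInd t (s + ∑ i ∈ range n, x i)) s ≤ n * G ^ 2 / (4 * t ^ 2) :=
  prob_dev_ge_le F G x n s h (gapLE_of_window hlo hhi hG hsucc x n s hw) ht

/-- Exponential tail with the window-local spacing (rational formats, probability cast to `ℝ`). -/
theorem prob_dev_ge_le_exp_of_window {F : Finset ℚ} {lo hi G : ℚ} (hlo : lo ∈ F) (hhi : hi ∈ F)
    (hG : 0 ≤ G) (hsucc : ∀ a ∈ F, lo ≤ a → a < hi → ∃ b ∈ F, a < b ∧ b ≤ a + G) (x : ℕ → ℚ)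
    (n : ℕ) (s : ℚ) (h : NoSat F x n s) (hw : InWindow F lo hi x n s) (t : ℚ) (ht : 0 < t) :
    ((accExp F x n (devInd t (s + ∑ i ∈ range n, x i)) s : ℚ) : ℝ)
      ≤ 2 * Real.exp (-2 * (t : ℝ) ^ 2 / (n * (G : ℝ) ^ 2)) :=
  prob_dev_ge_le_exp_rat F G x n s h (gapLE_of_window hlo hhi hG hsucc x n s hw) t ht

/-! ### Kernel window certificates

(The endpoint memberships are discharged inline by `decide +kernel`: passing them as named lemmas makes
the unifier unfold the 253-element literals and exceed the default recursion depth.) -/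

/-- E4M3 on the window `[−16, 16]`: local spacing `≤ 1` (kernel decision over the 253 values). -/
theorem Formats.e4m3_window16_succ :
    ∀ a ∈ Formats.e4m3, (-16 : ℚ) ≤ a → a < 16 → ∃ b ∈ Formats.e4m3, a < b ∧ b ≤ a + 1 := by
  decide +kernel

/-- **E4M3, partial sums within `[−16, 16]`**: `accVar ≤ n/4` (against the all-input `256 n`). -/
theorem Formats.e4m3_window16_accVar_le (x : ℕ → ℚ) (n : ℕ) (s : ℚ)
    (hw : InWindow Formats.e4m3 (-16) 16 x n s) : accVar Formats.e4m3 x n s ≤ n * 1 ^ 2 / 4 :=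
  accVar_le_of_window (by decide +kernel) (by decide +kernel) zero_le_one
    Formats.e4m3_window16_succ x n s hw

/-- **E4M3, partial sums within `[−16, 16]`, no saturation**: `P(|ŝₙ − s − ∑xₖ| ≥ t) ≤ 2 exp(−2t²/n)`
(against the all-input `2 exp(−t²/(512 n))`). -/
theorem Formats.e4m3_window16_exp (x : ℕ → ℚ) (n : ℕ) (s : ℚ) (h : NoSat Formats.e4m3 x n s)
    (hw : InWindow Formats.e4m3 (-16) 16 x n s) (t : ℚ) (ht : 0 < t) :
    ((accExp Formats.e4m3 x n (devInd t (s + ∑ i ∈ range n, x i)) s : ℚ) : ℝ)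
      ≤ 2 * Real.exp (-2 * (t : ℝ) ^ 2 / (n * ((1 : ℚ) : ℝ) ^ 2)) :=
  prob_dev_ge_le_exp_of_window (by decide +kernel) (by decide +kernel) zero_le_one
    Formats.e4m3_window16_succ x n s h hw t ht

/-- E5M2 (finite part) on the window `[−256, 256]`: local spacing `≤ 32`. -/
theorem Formats.e5m2_window256_succ :
    ∀ a ∈ Formats.e5m2, (-256 : ℚ) ≤ a → a < 256 → ∃ b ∈ Formats.e5m2, a < b ∧ b ≤ a + 32 := by
  decide +kernel

/-- **E5M2, partial sums within `[−256, 256]`**: `accVar ≤ 256 n` (against the all-input `2²⁴ n`). -/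
theorem Formats.e5m2_window256_accVar_le (x : ℕ → ℚ) (n : ℕ) (s : ℚ)
    (hw : InWindow Formats.e5m2 (-256) 256 x n s) : accVar Formats.e5m2 x n s ≤ n * 32 ^ 2 / 4 :=
  accVar_le_of_window (by decide +kernel) (by decide +kernel) (by norm_num)
    Formats.e5m2_window256_succ x n s hw

/-- **E5M2, partial sums within `[−256, 256]`, no saturation**:
`P(|ŝₙ − s − ∑xₖ| ≥ t) ≤ 2 exp(−2t²/(1024 n))` (against the all-input `2 exp(−t²/(2²⁵ n))`). -/
theorem Formats.e5m2_window256_exp (x : ℕ → ℚ) (n : ℕ) (s : ℚ) (h : NoSat Formats.e5m2 x n s)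
    (hw : InWindow Formats.e5m2 (-256) 256 x n s) (t : ℚ) (ht : 0 < t) :
    ((accExp Formats.e5m2 x n (devInd t (s + ∑ i ∈ range n, x i)) s : ℚ) : ℝ)
      ≤ 2 * Real.exp (-2 * (t : ℝ) ^ 2 / (n * ((32 : ℚ) : ℝ) ^ 2)) :=
  prob_dev_ge_le_exp_of_window (by decide +kernel) (by decide +kernel) (by norm_num)
    Formats.e5m2_window256_succ x n s h hw t ht

/-- E2M1 on the window `[−2, 2]`: local spacing `≤ 1/2`. -/
theorem FP4.e2m1_window2_succ :
    ∀ a ∈ FP4.e2m1, (-2 : ℚ) ≤ a → a < 2 → ∃ b ∈ FP4.e2m1, a < b ∧ b ≤ a + 1 / 2 := by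
  decide +kernel

/-- **E2M1, partial sums within `[−2, 2]`**: `accVar ≤ n/16` (against the all-input `n`). -/
theorem FP4.e2m1_window2_accVar_le (x : ℕ → ℚ) (n : ℕ) (s : ℚ)
    (hw : InWindow FP4.e2m1 (-2) 2 x n s) : accVar FP4.e2m1 x n s ≤ n * (1 / 2) ^ 2 / 4 :=
  accVar_le_of_window (by decide +kernel) (by decide +kernel) (by norm_num) FP4.e2m1_window2_succ
    x n s hw

/-- Kernel witness (E2M1): the non-representable inputs `(1/4, 1/4, 1/4)` from `0` stay in the window
`[−2, 2]` on every branch … -/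
theorem FP4.e2m1_window_witness_in : InWindow FP4.e2m1 (-2) 2 (FP4.seq3 (1/4) (1/4) (1/4)) 3 0 := by
  rw [← inWindowB_iff]; decide +kernel

/-- … never saturate, and have `accVar = 3/16`, ATTAINING the window bound `n (1/2)²/4 = 3/16`
(`FP4.e2m1_window2_accVar_le`) — the window constant is sharp. -/
theorem FP4.e2m1_window_witness_var :
    NoSat FP4.e2m1 (FP4.seq3 (1/4) (1/4) (1/4)) 3 0 ∧
    accVar FP4.e2m1 (FP4.seq3 (1/4) (1/4) (1/4)) 3 0 = 3 / 16 := by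
  decide +kernel

end Summit.Ventures.CertifiedArithmetic.LowPrec.SR
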